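import Summits.QuantumFields.YangMills.Theorems.BalabanUVNodesN07PointFeasibilityOneLevelRobust
import Summits.QuantumFields.YangMills.Theorems.BalabanUVNodesN07PointFeasibilityOneLevelTileForm
import HarnessLib

/-!
# DAG node N07 [B11], road R0′ ∕ (L4) road v1 — (S2) IN THE TILE-CRITERION LETTERS (dag-n07-w7 g6's consumer shape, I.≈39300): on the cubic one-level torus
# `TorusSite d (n·N₀)`, for REAL `w, v` and a real block density `β` with `Δ²w = q` (ANY real `q`) and `Δ²v = β∘blockOf`,
# `|Σ_x β(blockOf x)·(w(centre) − blockMean w)| ≤ √C(d,n)·n²·‖Δv‖·‖q‖` — FILE 4's `robustBound` ((R1L) in x-space) read through the dictionary `LapS = −n²·lap`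

Cell `pub-ymgap` (HUMAN RULINGS D-0062 ∕ D-0149 ∕ D-0154), width seat `pub-ymgap-dag-n07-w5` g3, CLAIM-6 ∕ INTENT-6 cell bus 2026-08-28 (dag-n07-w7 g6's ANSWER I.≈39300:
«YES — the dictionary from YOUR base, both halves, in the `TorusSite`∕`lap` letters on the cubic torus»; (S1) = `…OneLevelTileForm`, this is (S2)).
`--kind proof --supports stmt-QuantumFields-27364 --as helper` (K1⁹ per dag-lead KEY MAP v2; count-neutral).  THEOREMS ONLY.

THE PRINT.  [B5] = `[Balaban1984PropagatorsI]` CMP **95** (1984) 17–40: (1.20) p. 20, (1.21) p. 21, Sect. C p. 22, (1.29)–(1.33) p. 23; [B6] = `[Balaban1984PropagatorsII]` CMP **96**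
(1984) 223–250: (2.22) p. 226; [I] = `[Balaban1987RG1]` CMP **109** (1987) 249–301: (0.4) p. 253.

WHY ((L4) road v1, `LOCATED-KPOS-MULTILEVEL.md` §3–§4).  A localised bulk piece `u` on a one-level cubic torus has `Δ²u = g = β∘blockOf + q` with `β` the block means of `g`
and `q` the residual of zero block means; with ANY `v` solving `Δ²v = β∘blockOf`, `w := u − v` solves `Δ²w = q`, and the centre functional of the tile criterion splits into
the `v`-part (sign-definite: (S1), `…OneLevelTileForm.centreFunctional_le_zero`) and the `w`-part, which (S2) bounds by `√C(d,n)·n²·‖Δv‖·‖q‖`.  FILE 4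
(`…OneLevelRobust.robustBound`) is this bound in b05's complex letters (`Δ⁻² = LapSinv²`, `Q′ = QsOp`); here it is read on real `w, v, q, β` through `LapS n = −n²·lap`
(`…OneLevelTileForm.LapS_ofReal_apply`): `Δ_{b05}⁻²(n⁴q) = w − w̄`, `Δ_{b05}⁻¹Q′ᴴβ = −n^{−(d+2)}·lap v`, `Σβ = 0` from `Δ²v = β∘blockOf`.

WHAT THIS FILE DOES (namespace `Summit.QuantumFields.YangMills.BalabanUVNodes.N07PointFeasibilityOneLevelTileForm`, continued; `M = fun _ => N₀`, odd `n ≥ 3`, `n = 2c₀+1`,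
`C(d,n) = (π²∕4)^d(π⁴∕1024 + d²π⁴n^d∕64)`; block mean of `w` at `y` = `(Σ_j w(bpt y j))∕n^d`).
* §0 dictionary: `lap_sub` · `lapSinv_lapSinv_of_LapS_LapS` (`Δ²μ = r ⇒ Δ⁻²r = μ − P_const μ`) · `centreSubMean_eq_ofReal` (b05's pairing function on `Δ⁻²(n⁴q_ℂ)` is the real
  «centre value minus block mean» of `w`) · `sum_eq_zero_of_lap_lap_eq_blockOf` (`Σ_y β(y) = 0`) · `norm_sq_lapSinv_QsOpH_ofReal` (`Σ‖Δ⁻¹Q′ᴴβ_ℂ‖² = (n^{d+2})⁻²·Σ(lap v)²`).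
* §1 ★★★ `abs_centreSubMean_pairing_le` (THE (S2) SHAPE): hypotheses (i) `lap (lap w) = q` (no condition on `q` — the zero-block-mean case is the one
  (L4) uses, but the inequality needs none), (ii) `lap (lap v) x = β (blockOf x)` ⇒
  `|Σ_x β(blockOf x)·(w(bpt (blockOf x) c₀) − (Σ_j w(bpt (blockOf x) j))∕n^d)| ≤ √C(d,n)·n²·√(Σ_x (lap v x)²)·√(Σ_x (q x)²)`;
  `abs_centreSubMean_pairing_le_coarse` (the `Σ_y` form, factor `n²∕n^d`).
* §2 ★★ `abs_centreSubMean_pairing_le_of_split` — dag-n07-w7 g6's `u`-letters: `g := lap (lap u)`, `β_y := (Σ_j g(bpt y j))∕n^d`, `q := g − β∘blockOf`, any `v` with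
  `lap (lap v) = β∘blockOf`: the §1 bound for `w := u − v`.

HONEST FRAMING (binding).  Count-neutral helper; dictionary bookkeeping on a CUBIC one-level torus BY NAME over FILE 4 (p639777) ∕ FILE 5 (p641263) ∕ dag-n07-w7 g6's p637570; the constant
is crude and `M`-independent; nothing of [B11]∕[B6]∕[B5]∕[3]'s analysis is asserted; (L4)'s (S3)–(S5) and `(P)_D` for Bałaban's d = 4 nested geometries stay OPEN; under road
(a) of the K0 lineage nothing here is consumed — located-research insurance for the R0′-native junction.  `hker` at the record ∕ stub 1 ∕ K0⁷ ∕ K1⁹ NOT closed; N07 NOT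
discharged; counts unmoved; no summit statement is proved by this seat — R4 closes the conditional finite-𝕋⁴ rung `BalabanLadder.UV` only; nothing continuum ∕ ℝ⁴ ∕ OS ∕ mass
gap ∕ Clay.  No `sorry`, no `def`, no `instance`, no `notation`.
-/

noncomputable section

open scoped BigOperators Matrix ComplexConjugate

namespace Summit.QuantumFields.YangMills.BalabanUVNodes.N07PointFeasibilityOneLevelTileForm

open Literature.MathematicalPhysics.QuantumFieldTheory.Balaban1983to89
open Literature.Probability.LatticeModels (TorusSite)
open B5Prop11Plancherel (Tor fine)
open B5Block118 (bpt QsOp QsOp_mulVec)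
open B5Blocks16 (blockOf bpt_bijective blockOf_bpt)
open B5Action121 (LapS)
open B5LaplaceInverse (LapSinv Pker LapSinv_LapS_of_orth LapSinv_mul_LapS Pker_const)
open B5Substitution125 (QsOp_const)
open B5Adjoint130 (QsOp_adjoint_mulVec)
open Summit.QuantumFields.YangMills.Theorems.N07PointFeasibilityEnergyIdentity (lap sum_lap)
open N07PointFeasibilityOneLevelEnergyBound (lapSinv_QsOpH_eq_LapS)
open N07PointFeasibilityOneLevelRobustBridge (robustBound)

variable {d : ℕ} (n N₀ : ℕ) [NeZero n] [NeZero N₀]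

/-! ## §0  Dictionary -/

section Dictionary

omit [NeZero n] [NeZero N₀] in
/-- `lap` is additive: `lap (f − g) = lap f − lap g`. [folklore] -/
theorem lap_sub {L : ℕ} (f g : TorusSite d L → ℝ) (x : TorusSite d L) :
    lap (fun y => f y - g y) x = lap f x - lap g x := by
  simp only [lap, ← Finset.sum_sub_distrib]
  exact Finset.sum_congr rfl fun i _ => by ring

omit [NeZero n] in
/-- `Δ²μ = r ⇒ Δ⁻²r = μ − P_const μ` (b05's pseudo-inverse: `Δ⁻¹Δ = 1 − P_const`, `Δμ ⊥ 1`). [cite: Balaban1984PropagatorsI, Sect. C p.22] -/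
theorem lapSinv_lapSinv_of_LapS_LapS {n' : ℕ} [NeZero n'] (M : Fin d → ℕ) [∀ μ, NeZero (M μ)] (μ r : Tor (fine n' M) → ℂ)
    (h : LapS (fine n' M) (n' : ℂ) *ᵥ (LapS (fine n' M) (n' : ℂ) *ᵥ μ) = r) :
    LapSinv (fine n' M) (n' : ℂ) *ᵥ (LapSinv (fine n' M) (n' : ℂ) *ᵥ r) = μ - Pker (fine n' M) (n' : ℂ) *ᵥ μ := by
  have hnc : (n' : ℂ) ≠ 0 := by exact_mod_cast NeZero.ne n'
  rw [← h, LapSinv_LapS_of_orth (fine n' M) hnc _ (B5DivOrth.sum_LapS (fine n' M) (n' : ℂ) μ), Matrix.mulVec_mulVec, LapSinv_mul_LapS,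
    Matrix.sub_mulVec, Matrix.one_mulVec]

/-- b05's `Q′` on a real function is the block mean: `(Q′ w_ℂ)(y) = (Σ_j w(bpt y j))∕n^d`. [cite: Balaban1984PropagatorsI, (1.20) p.20] -/
theorem QsOp_ofReal_apply (w : TorusSite d (n * N₀) → ℝ) (y : Tor (fun _ : Fin d => N₀)) :
    (QsOp n (fun _ : Fin d => N₀) *ᵥ (fun z : Tor (fine n (fun _ : Fin d => N₀)) => ((w z : ℝ) : ℂ))) y
      = (((∑ j : Fin d → Fin n, w (bpt n (fun _ : Fin d => N₀) y j)) / (n : ℝ) ^ d : ℝ) : ℂ) := by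
  rw [QsOp_mulVec]
  push_cast
  ring

/-- **The pairing function of FILE 4 on `r = n⁴·q_ℂ` with `Δ²w = q` is the real «centre value minus block mean» of `w`** (constants cancel: `Q′` fixes constants).
[cite: Balaban1984PropagatorsI, (1.20) p.20, Sect. C p.22; Balaban1987RG1, (0.4) p.253] -/
theorem centreSubMean_eq_ofReal (c₀ : Fin d → Fin n) (w q : TorusSite d (n * N₀) → ℝ)
    (hw : ∀ x : Tor (fine n (fun _ : Fin d => N₀)), lap (lap w) x = q x) (y : Tor (fun _ : Fin d => N₀)) :
    (LapSinv (fine n (fun _ : Fin d => N₀)) (n : ℂ) *ᵥ (LapSinv (fine n (fun _ : Fin d => N₀)) (n : ℂ) *ᵥ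
        (fun z : Tor (fine n (fun _ : Fin d => N₀)) => ((((n : ℝ) ^ 4 * q z : ℝ)) : ℂ)))) (bpt n (fun _ : Fin d => N₀) y c₀) -
      (QsOp n (fun _ : Fin d => N₀) *ᵥ (LapSinv (fine n (fun _ : Fin d => N₀)) (n : ℂ) *ᵥ (LapSinv (fine n (fun _ : Fin d => N₀)) (n : ℂ) *ᵥ
        (fun z : Tor (fine n (fun _ : Fin d => N₀)) => ((((n : ℝ) ^ 4 * q z : ℝ)) : ℂ))))) y
      = ((w (bpt n (fun _ : Fin d => N₀) y c₀) - (∑ j : Fin d → Fin n, w (bpt n (fun _ : Fin d => N₀) y j)) / (n : ℝ) ^ d : ℝ) : ℂ) := by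
  have hnc : (n : ℂ) ≠ 0 := by exact_mod_cast NeZero.ne n
  -- `Δ_{b05}²(w_ℂ) = n⁴ q`
  have hLL : LapS (fine n (fun _ : Fin d => N₀)) (n : ℂ) *ᵥ (LapS (fine n (fun _ : Fin d => N₀)) (n : ℂ) *ᵥ
      (fun z : Tor (fine n (fun _ : Fin d => N₀)) => ((w z : ℝ) : ℂ))) =
      fun z : Tor (fine n (fun _ : Fin d => N₀)) => ((((n : ℝ) ^ 4 * q z : ℝ)) : ℂ) := by
    funext z
    rw [LapS_LapS_ofReal_apply, hw z]
    push_cast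
    ring
  rw [lapSinv_lapSinv_of_LapS_LapS (fun _ : Fin d => N₀) _ _ hLL]
  -- the constant `P_const w_ℂ` drops out
  have hPk : Pker (fine n (fun _ : Fin d => N₀)) (n : ℂ) *ᵥ (fun z : Tor (fine n (fun _ : Fin d => N₀)) => ((w z : ℝ) : ℂ)) =
      fun _ => (Pker (fine n (fun _ : Fin d => N₀)) (n : ℂ) *ᵥ (fun z : Tor (fine n (fun _ : Fin d => N₀)) => ((w z : ℝ) : ℂ))) 0 :=
    funext fun x => Pker_const (fine n (fun _ : Fin d => N₀)) hnc _ x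
  rw [Matrix.mulVec_sub, hPk, QsOp_const, Pi.sub_apply, Pi.sub_apply, QsOp_ofReal_apply]
  push_cast
  ring

/-- `Δ²v = β∘blockOf ⇒ Σ_y β(y) = 0` on the cubic one-level torus (`Σ Δ = 0`, each block has `n^d` sites). [folklore] -/
theorem sum_eq_zero_of_lap_lap_eq_blockOf (v : TorusSite d (n * N₀) → ℝ) (β : Tor (fun _ : Fin d => N₀) → ℝ)
    (hv : ∀ x : Tor (fine n (fun _ : Fin d => N₀)), lap (lap v) x = β (blockOf n (fun _ : Fin d => N₀) x)) : ∑ y, β y = 0 := by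
  haveI : NeZero (n * N₀) := ⟨Nat.mul_ne_zero (NeZero.ne n) (NeZero.ne N₀)⟩
  have hn0 : (n : ℝ) ^ d ≠ 0 := pow_ne_zero _ (by exact_mod_cast NeZero.ne n)
  have h1 : ∑ x : Tor (fine n (fun _ : Fin d => N₀)), β (blockOf n (fun _ : Fin d => N₀) x) = 0 := by
    rw [← sum_lap (N := n * N₀) (lap v)]
    exact Finset.sum_congr rfl fun x _ => (hv x).symm
  rw [sum_comp_blockOf n N₀ β] at h1
  exact (mul_eq_zero.mp h1).resolve_left hn0

/-- **`Δ_{b05}⁻¹Q′ᴴβ_ℂ = −(n^{d+2})⁻¹·lap v`** when `Δ²v = β∘blockOf` (FILE 2's `lapSinv_QsOpH_eq_LapS` for `ṽ = v∕n^{d+4}`), hence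
`Σ_x ‖(Δ⁻¹Q′ᴴβ_ℂ)(x)‖² = ((n^{d+2})⁻¹)²·Σ_x (lap v x)²`. [cite: Balaban1984PropagatorsI, Sect. C p.22, (1.32)-(1.33) p.23] -/
theorem norm_sq_lapSinv_QsOpH_ofReal (v : TorusSite d (n * N₀) → ℝ) (β : Tor (fun _ : Fin d => N₀) → ℝ)
    (hv : ∀ x : Tor (fine n (fun _ : Fin d => N₀)), lap (lap v) x = β (blockOf n (fun _ : Fin d => N₀) x)) :
    ∑ x, ‖(LapSinv (fine n (fun _ : Fin d => N₀)) (n : ℂ) *ᵥ ((QsOp n (fun _ : Fin d => N₀))ᴴ *ᵥ (fun y => ((β y : ℝ) : ℂ)))) x‖ ^ 2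
      = (((n : ℝ) ^ (d + 2))⁻¹) ^ 2 * ∑ x : Tor (fine n (fun _ : Fin d => N₀)), lap v x ^ 2 := by
  have hn0 : (n : ℝ) ≠ 0 := by exact_mod_cast NeZero.ne n
  have hnc : (n : ℂ) ≠ 0 := by exact_mod_cast NeZero.ne n  -- used by `field_simp`
  -- `ṽ := v ∕ n^{d+4}` solves `Δ_{b05}² ṽ_ℂ = Q′ᴴ β_ℂ`
  have hbi : LapS (fine n (fun _ : Fin d => N₀)) (n : ℂ) *ᵥ (LapS (fine n (fun _ : Fin d => N₀)) (n : ℂ) *ᵥ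
      (fun z : Tor (fine n (fun _ : Fin d => N₀)) => (((((n : ℝ) ^ (d + 4))⁻¹ * v z : ℝ)) : ℂ))) =
      (QsOp n (fun _ : Fin d => N₀))ᴴ *ᵥ (fun y => ((β y : ℝ) : ℂ)) := by
    funext x
    rw [LapS_LapS_ofReal_apply, QsOp_adjoint_mulVec]
    have hlin : lap (lap (fun z : TorusSite d (n * N₀) => ((n : ℝ) ^ (d + 4))⁻¹ * v z)) x = ((n : ℝ) ^ (d + 4))⁻¹ * lap (lap v) x := by
      have e1 : lap (fun z : TorusSite d (n * N₀) => ((n : ℝ) ^ (d + 4))⁻¹ * v z) = fun z => ((n : ℝ) ^ (d + 4))⁻¹ * lap v z :=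
        funext fun z => lap_const_mul _ v z
      rw [e1, lap_const_mul]
    rw [hlin, hv x]
    push_cast
    field_simp
    ring
  have hstep := lapSinv_QsOpH_eq_LapS n (fun _ : Fin d => N₀) _ _ hbi
  rw [hstep, Finset.mul_sum]
  refine Finset.sum_congr rfl fun x _ => ?_
  rw [LapS_ofReal_apply, lap_const_mul, norm_mul, norm_neg, norm_pow, Complex.norm_natCast, Complex.norm_real, Real.norm_eq_abs, mul_pow, sq_abs]
  field_simp
  ring

end Dictionary

/-! ## §1  (S2) in the tile-criterion letters -/

section S2

/-- ★★★ **(S2) IN THE (L4) ROAD'S LETTERS.**  Cubic one-level torus `TorusSite d (n·N₀)`, odd `n ≥ 3`, `n = 2c₀+1`; REAL `w, v, q` and a real block density `β` with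
(i) `lap (lap w) = q` (ANY real `q`; in the (L4) use `q` has zero block means, which the inequality does not need) and (ii) `lap (lap v) x = β(blockOf x)`.  Then
`|Σ_x β(blockOf x)·(w(bpt (blockOf x) c₀) − (Σ_j w(bpt (blockOf x) j))∕n^d)| ≤ √C(d,n) · n² · √(Σ_x (lap v x)²) · √(Σ_x (q x)²)`, `C(d,n) = (π²∕4)^d(π⁴∕1024 + d²π⁴n^d∕64)`
— FILE 4's `robustBound` at `β_ℂ`, `r := n⁴·q_ℂ` through §0.  [cite: Balaban1984PropagatorsI, (1.29)-(1.33) p.23; Balaban1984PropagatorsII, (2.22) p.226; Balaban1987RG1, (0.4) p.253] -/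
theorem abs_centreSubMean_pairing_le (hn : Odd n) (h3 : 3 ≤ n) (c₀ : Fin d → Fin n) (hc₀ : ∀ ν, 2 * (c₀ ν : ℕ) + 1 = n)
    (w v q : TorusSite d (n * N₀) → ℝ) (β : Tor (fun _ : Fin d => N₀) → ℝ)
    (hw : ∀ x : Tor (fine n (fun _ : Fin d => N₀)), lap (lap w) x = q x)
    (hv : ∀ x : Tor (fine n (fun _ : Fin d => N₀)), lap (lap v) x = β (blockOf n (fun _ : Fin d => N₀) x)) :
    |∑ x : Tor (fine n (fun _ : Fin d => N₀)), β (blockOf n (fun _ : Fin d => N₀) x) *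
        (w (bpt n (fun _ : Fin d => N₀) (blockOf n (fun _ : Fin d => N₀) x) c₀) -
          (∑ j : Fin d → Fin n, w (bpt n (fun _ : Fin d => N₀) (blockOf n (fun _ : Fin d => N₀) x) j)) / (n : ℝ) ^ d)|
      ≤ Real.sqrt ((Real.pi ^ 2 / 4) ^ d * (Real.pi ^ 4 / 1024 + (d : ℝ) ^ 2 * Real.pi ^ 4 * (n : ℝ) ^ d / 64)) * (n : ℝ) ^ 2 *
          Real.sqrt (∑ x : Tor (fine n (fun _ : Fin d => N₀)), lap v x ^ 2) * Real.sqrt (∑ x : Tor (fine n (fun _ : Fin d => N₀)), q x ^ 2) := by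
  have hn0 : (n : ℝ) ≠ 0 := by exact_mod_cast NeZero.ne n
  have hnpos : (0 : ℝ) < n := by exact_mod_cast Nat.pos_of_ne_zero (NeZero.ne n)
  -- the complex letters of FILE 4
  obtain ⟨βc, hβc⟩ : ∃ βc : Tor (fun _ : Fin d => N₀) → ℂ, βc = fun y => ((β y : ℝ) : ℂ) := ⟨_, rfl⟩
  obtain ⟨r, hr⟩ : ∃ r : Tor (fine n (fun _ : Fin d => N₀)) → ℂ, r = fun z => ((((n : ℝ) ^ 4 * q z : ℝ)) : ℂ) := ⟨_, rfl⟩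
  have hβ0 : ∑ y, βc y = 0 := by
    rw [hβc]; simp only [← Complex.ofReal_sum, sum_eq_zero_of_lap_lap_eq_blockOf n N₀ v β hv, Complex.ofReal_zero]
  have hRB := robustBound n (fun _ : Fin d => N₀) hn h3 c₀ hc₀ βc hβ0 r
  -- left side: the real pairing over the coarse torus
  have hE : ∀ y : Tor (fun _ : Fin d => N₀),
      (LapSinv (fine n (fun _ : Fin d => N₀)) (n : ℂ) *ᵥ (LapSinv (fine n (fun _ : Fin d => N₀)) (n : ℂ) *ᵥ r)) (bpt n (fun _ : Fin d => N₀) y c₀) -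
        (QsOp n (fun _ : Fin d => N₀) *ᵥ (LapSinv (fine n (fun _ : Fin d => N₀)) (n : ℂ) *ᵥ (LapSinv (fine n (fun _ : Fin d => N₀)) (n : ℂ) *ᵥ r))) y
        = ((w (bpt n (fun _ : Fin d => N₀) y c₀) - (∑ j : Fin d → Fin n, w (bpt n (fun _ : Fin d => N₀) y j)) / (n : ℝ) ^ d : ℝ) : ℂ) := by
    intro y; rw [hr]; exact centreSubMean_eq_ofReal n N₀ c₀ w q hw y
  have hL : ‖star βc ⬝ᵥ (fun y => (LapSinv (fine n (fun _ : Fin d => N₀)) (n : ℂ) *ᵥ (LapSinv (fine n (fun _ : Fin d => N₀)) (n : ℂ) *ᵥ r))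
        (bpt n (fun _ : Fin d => N₀) y c₀) -
        (QsOp n (fun _ : Fin d => N₀) *ᵥ (LapSinv (fine n (fun _ : Fin d => N₀)) (n : ℂ) *ᵥ (LapSinv (fine n (fun _ : Fin d => N₀)) (n : ℂ) *ᵥ r))) y)‖
      = |∑ y : Tor (fun _ : Fin d => N₀), β y * (w (bpt n (fun _ : Fin d => N₀) y c₀) -
          (∑ j : Fin d → Fin n, w (bpt n (fun _ : Fin d => N₀) y j)) / (n : ℝ) ^ d)| := by
    simp only [dotProduct, Pi.star_apply, hE, hβc, Complex.star_def, Complex.conj_ofReal, ← Complex.ofReal_mul, ← Complex.ofReal_sum,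
      Complex.norm_real, Real.norm_eq_abs]
  -- right side: the two norms
  have hK : ∑ x, ‖(LapSinv (fine n (fun _ : Fin d => N₀)) (n : ℂ) *ᵥ ((QsOp n (fun _ : Fin d => N₀))ᴴ *ᵥ βc)) x‖ ^ 2
      = (((n : ℝ) ^ (d + 2))⁻¹) ^ 2 * ∑ x : Tor (fine n (fun _ : Fin d => N₀)), lap v x ^ 2 := by
    rw [hβc]; exact norm_sq_lapSinv_QsOpH_ofReal n N₀ v β hv
  have hQ : ∑ x, ‖r x‖ ^ 2 = ((n : ℝ) ^ 4) ^ 2 * ∑ x : Tor (fine n (fun _ : Fin d => N₀)), q x ^ 2 := by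
    rw [hr, Finset.mul_sum]
    refine Finset.sum_congr rfl fun x _ => ?_
    rw [Complex.norm_real, Real.norm_eq_abs, sq_abs]
    ring
  have hKs : Real.sqrt ((((n : ℝ) ^ (d + 2))⁻¹) ^ 2 * ∑ x : Tor (fine n (fun _ : Fin d => N₀)), lap v x ^ 2)
      = ((n : ℝ) ^ (d + 2))⁻¹ * Real.sqrt (∑ x : Tor (fine n (fun _ : Fin d => N₀)), lap v x ^ 2) := by
    rw [Real.sqrt_mul' _ (Finset.sum_nonneg fun _ _ => sq_nonneg _), Real.sqrt_sq (by positivity)]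
  have hQs : Real.sqrt (((n : ℝ) ^ 4) ^ 2 * ∑ x : Tor (fine n (fun _ : Fin d => N₀)), q x ^ 2)
      = (n : ℝ) ^ 4 * Real.sqrt (∑ x : Tor (fine n (fun _ : Fin d => N₀)), q x ^ 2) := by
    rw [Real.sqrt_mul' _ (Finset.sum_nonneg fun _ _ => sq_nonneg _), Real.sqrt_sq (by positivity)]
  rw [hL, hK, hQ, hKs, hQs] at hRB
  -- coarse form ⇒ Σ_x form (each block has `n^d` sites)
  rw [sum_comp_blockOf n N₀ (fun y => β y * (w (bpt n (fun _ : Fin d => N₀) y c₀) -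
      (∑ j : Fin d → Fin n, w (bpt n (fun _ : Fin d => N₀) y j)) / (n : ℝ) ^ d)), abs_mul, abs_of_pos (by positivity)]
  have hpow : (n : ℝ) ^ d * (((n : ℝ) ^ (d + 2))⁻¹ * ((n : ℝ) ^ 4)) = (n : ℝ) ^ 2 := by
    field_simp
    ring
  calc (n : ℝ) ^ d * |∑ y : Tor (fun _ : Fin d => N₀), β y * (w (bpt n (fun _ : Fin d => N₀) y c₀) -
          (∑ j : Fin d → Fin n, w (bpt n (fun _ : Fin d => N₀) y j)) / (n : ℝ) ^ d)|
      ≤ (n : ℝ) ^ d * (Real.sqrt ((Real.pi ^ 2 / 4) ^ d * (Real.pi ^ 4 / 1024 + (d : ℝ) ^ 2 * Real.pi ^ 4 * (n : ℝ) ^ d / 64)) *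
          (((n : ℝ) ^ (d + 2))⁻¹ * Real.sqrt (∑ x : Tor (fine n (fun _ : Fin d => N₀)), lap v x ^ 2)) *
          ((n : ℝ) ^ 4 * Real.sqrt (∑ x : Tor (fine n (fun _ : Fin d => N₀)), q x ^ 2))) := by gcongr
    _ = Real.sqrt ((Real.pi ^ 2 / 4) ^ d * (Real.pi ^ 4 / 1024 + (d : ℝ) ^ 2 * Real.pi ^ 4 * (n : ℝ) ^ d / 64)) *
          ((n : ℝ) ^ d * (((n : ℝ) ^ (d + 2))⁻¹ * ((n : ℝ) ^ 4))) *
          Real.sqrt (∑ x : Tor (fine n (fun _ : Fin d => N₀)), lap v x ^ 2) * Real.sqrt (∑ x : Tor (fine n (fun _ : Fin d => N₀)), q x ^ 2) := by ring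
    _ = _ := by rw [hpow]

end S2

/-! ## §2  dag-n07-w7 g6's `u`-letters: the split `Δ²u = β∘blockOf + q` -/

section Split

/-- ★★ **(S2), consumer form**: for REAL `u, v` on the cubic one-level torus with `g := lap (lap u)`, block means `β_y := (Σ_j g(bpt y j))∕n^d`, residual
`q := g − β∘blockOf`, and ANY `v` with `lap (lap v) x = β(blockOf x)`, the function `w := u − v` obeys §1's bound:
`|Σ_x β(blockOf x)·(w(bpt (blockOf x) c₀) − (Σ_j w(bpt (blockOf x) j))∕n^d)| ≤ √C(d,n)·n²·√(Σ_x (lap v x)²)·√(Σ_x q(x)²)`.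
[cite: Balaban1984PropagatorsI, (1.29)-(1.33) p.23; Balaban1984PropagatorsII, (2.22) p.226; Balaban1987RG1, (0.4) p.253] -/
theorem abs_centreSubMean_pairing_le_of_split (hn : Odd n) (h3 : 3 ≤ n) (c₀ : Fin d → Fin n) (hc₀ : ∀ ν, 2 * (c₀ ν : ℕ) + 1 = n)
    (u v : TorusSite d (n * N₀) → ℝ)
    (hv : ∀ x : Tor (fine n (fun _ : Fin d => N₀)), lap (lap v) x =
      (∑ j : Fin d → Fin n, lap (lap u) (bpt n (fun _ : Fin d => N₀) (blockOf n (fun _ : Fin d => N₀) x) j)) / (n : ℝ) ^ d) :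
    |∑ x : Tor (fine n (fun _ : Fin d => N₀)),
        ((∑ j : Fin d → Fin n, lap (lap u) (bpt n (fun _ : Fin d => N₀) (blockOf n (fun _ : Fin d => N₀) x) j)) / (n : ℝ) ^ d) *
        ((u (bpt n (fun _ : Fin d => N₀) (blockOf n (fun _ : Fin d => N₀) x) c₀) - v (bpt n (fun _ : Fin d => N₀) (blockOf n (fun _ : Fin d => N₀) x) c₀)) -
          (∑ j : Fin d → Fin n, (u (bpt n (fun _ : Fin d => N₀) (blockOf n (fun _ : Fin d => N₀) x) j) -
            v (bpt n (fun _ : Fin d => N₀) (blockOf n (fun _ : Fin d => N₀) x) j))) / (n : ℝ) ^ d)|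
      ≤ Real.sqrt ((Real.pi ^ 2 / 4) ^ d * (Real.pi ^ 4 / 1024 + (d : ℝ) ^ 2 * Real.pi ^ 4 * (n : ℝ) ^ d / 64)) * (n : ℝ) ^ 2 *
          Real.sqrt (∑ x : Tor (fine n (fun _ : Fin d => N₀)), lap v x ^ 2) *
          Real.sqrt (∑ x : Tor (fine n (fun _ : Fin d => N₀)),
            (lap (lap u) x - (∑ j : Fin d → Fin n, lap (lap u) (bpt n (fun _ : Fin d => N₀) (blockOf n (fun _ : Fin d => N₀) x) j)) / (n : ℝ) ^ d) ^ 2) := by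
  -- letters: `β`, `q`, `w`
  obtain ⟨β, hβ⟩ : ∃ β : Tor (fun _ : Fin d => N₀) → ℝ, β = fun y =>
      (∑ j : Fin d → Fin n, lap (lap u) (bpt n (fun _ : Fin d => N₀) y j)) / (n : ℝ) ^ d := ⟨_, rfl⟩
  obtain ⟨q, hq⟩ : ∃ q : TorusSite d (n * N₀) → ℝ, q = fun x : Tor (fine n (fun _ : Fin d => N₀)) =>
      lap (lap u) x - β (blockOf n (fun _ : Fin d => N₀) x) := ⟨_, rfl⟩
  obtain ⟨w, hw⟩ : ∃ w : TorusSite d (n * N₀) → ℝ, w = fun x => u x - v x := ⟨_, rfl⟩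
  have hv' : ∀ x : Tor (fine n (fun _ : Fin d => N₀)), lap (lap v) x = β (blockOf n (fun _ : Fin d => N₀) x) := fun x => by rw [hβ]; exact hv x
  have hw' : ∀ x : Tor (fine n (fun _ : Fin d => N₀)), lap (lap w) x = q x := by
    intro x
    have e1 : lap w = fun y => lap u y - lap v y := by rw [hw]; funext y; exact lap_sub u v y
    rw [e1, lap_sub, hq, hv' x]
  have h := abs_centreSubMean_pairing_le n N₀ hn h3 c₀ hc₀ w v q β hw' hv'
  simp only [hw, hq, hβ] at h
  exact h

end Split

end Summit.QuantumFields.YangMills.BalabanUVNodes.N07PointFeasibilityOneLevelTileForm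

end
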